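import Summits.AtomisticToContinuum.Crystallization.Theorems.FluxTubeKeplerFloorGivesLayered
import Summits.AtomisticToContinuum.Crystallization.Theorems.FluxTubeKeplerFluxCellKeplerSingleScale
import Summits.AtomisticToContinuum.Crystallization.Theorems.ChessboardParticlePlanesPeriodicWindowsIffCrystallization

/-!
# G22 banked candidate (NOT a registered line) — the COORDINATION-FLOOR ladder `KRung k r` over `FluxTubeKepler.FloorGivesLayered`

Forward generator G1 (gen 22), seed `g1-AtomisticToContinuum-15223` =
`FluxTubeKeplerFloorGivesLayered.FloorGivesLayered_proof` (the FLOOR), crux dir `FluxCellKepler`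
(stmt-AtomisticToContinuum-15221).  OUTCOME OF THE SEAT: `critic-rejected` / found-nothing — this file
only BANKS the best typed candidate so that it is machine-harvestable (F7).  It is NOT filed as a line:
the candidate gives the open crux `FluxCellKepler` ZERO RELIEF (§Relief) and its first non-floor member
is flat modulo an elementary structural lemma (§Flatness).

THE DIAL.  The floor: FLOOR(P₀) (`N·e(P₀) ≤ E(x)` on Lennard-Jones ground states) + BUDGET(P₀) (at every
scale `(R, η)` some `c > 0` with `c · #{(R, η)-bad sites} ≤ E(x) − N·e(P₀)` on ground states) ⇒ layered,
hence periodic, windows along every ground-state sequence.  Here the budget carries a COORDINATION FLOOR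
`k : ℕ` at a fixed bond radius `r`: only the `(R, η)`-bad sites having AT LEAST `k` other particles within
distance `r` are priced; UNDER-COORDINATED bad sites (`< k` particles within `r`: isolated atoms, dangling
atoms, adatoms, surface vertices …) go free.  `k = 0` prices every bad site: `KRung 0 r` IS the floor
(`kRung_zero`, F3).  The family is monotone (`kRung_mono`: raising `k` un-prices more sites, the rung gets
stronger).  Banked candidate: `BondedRung := KRung 1 (8/7)` — "a certificate that never prices an
`8/7`-ISOLATED defect already forces periodic windows" (`(8/7)⁶ = 262144/117649 > 11/5`, see §Flatness).
This axis (a coordination FLOOR on the priced class) is not among the registered dials gens 1–16, 18, 21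
(tolerance, vacancy, radius, registry, spacing, grain, energy, competitor, strain, margin rate, hard core,
one point, interlayer, rebonding, currency, kissing, annulus, sparse/crowd); the coordination CAP (`≤ 12`)
is in cone (G17 census C, `CrystalKissingRigidity.SoftTwelveCoordination`, `TruncatedCensusGap`).

ON PATH (F4): `Crystallization → KRung k r` for every `k, r` (`kRung_of_crystallization`, through the landed
`periodicWindows_of_crystallization`), hence `BondedRung_of_Crystallization`.

§Flatness (k = 1).  SUPERHARMONIC CUT: for `V = lennardJones` (`(1/12)r⁻¹² − (1/6)r⁻⁶`),
`ΔV(|·|)(r) = V''(r) + (2/r)V'(r) = 11 r⁻¹⁴ − 5 r⁻⁸ < 0` iff `r⁶ > 11/5`.  If a particle `i` of a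
configuration with `N ≥ 2` had every other particle at distance `> (11/5)^{1/6} ≈ 1.1404`, then
`t ↦ ∑ⱼ V(|xᵢ + t − xⱼ|)` would be strictly superharmonic at `t = 0`, so `t = 0` is not a local minimum
and `x` is not a ground state.  Hence `NoIsolatedSite r` below holds for every `r ≥ (11/5)^{1/6}`, in
particular `r = 8/7`; given it, the `k = 1` budget coincides with the floor's budget for `N ≥ 2`
(for `N ≤ 1` the floor's budget holds with `c ≤ −e(P₀)` since `E = 0`, `e(P₀) = e⋆ < 0`), so
`BondedRung` is the floor plus an elementary lemma — no new input toward `FluxCellKepler`.  (The same cut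
applied to a rigid translate of a whole sub-cluster shows ground states are `(11/5)^{1/6}`-CONNECTED —
banked under NOTES.md `## Barrier notes` as a category-(ii) structural lemma.)

§Relief (every k).  A site with `m ≤ k − 1 ≤ 10` particles within `r ≤ 8/7` has half-site-energy
`≥ −m/24 − (tail beyond r)` which exceeds `e⋆ ≈ −0.717` by a margin once the tail is controlled by the
minimal-distance packing bound — i.e. under-coordinated stars are priced FOR FREE by the one-centre bound
that any cell certificate (`FluxCellKepler`'s `φ ≥ e⋆ + c` on non-Barlow stars) contains; the hard stars
(icosahedral / over-packed, `TetrahedralFrustration`) all have `≥ 12` particles within `r` and stay priced.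
For `k ≥ 10` the restoring statement "under-coordinated sites are `o(N)`" is still true-ish but for
`k ≥ 13` at `r < 1.05` the un-priced class is everything non-kissing and the rung is summit-strength
(`SoftTwelveCoordination`).  So the ladder is: flat at `k = 1`, zero-relief for `2 ≤ k ≤ 12`, in cone /
summit-adjacent at `k = 13`.
-/

noncomputable section

namespace Summit.AtomisticToContinuum.Crystallization.Cruxes.FluxCellKepler.CoordLadder

open Filter Topology
open Literature.MathematicalPhysics.StatisticalMechanics
open Summit.AtomisticToContinuum.Crystallization.Theorems.FluxCellKeplerSingleScale (LayeredGood)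

local notation "E3" => EuclideanSpace ℝ (Fin 3)

/-! ## The graded family -/

/-- FLOOR(P₀): `N·e(P₀) ≤ E(x)` for every Lennard-Jones ground state `x` (verbatim the first hypothesis
of `FluxTubeKepler.FloorGivesLayered`). -/
def Floor (P₀ : PeriodicConfiguration 3) : Prop :=
  ∀ (N : ℕ) (x : Fin N → E3), IsGroundState lennardJones x →
    (N : ℝ) * P₀.energyPerParticle lennardJones ≤ interactionEnergy lennardJones x

/-- The number of OTHER particles of `x` within distance `r` of particle `i` (its `r`-coordination). -/
def nearCount (r : ℝ) {N : ℕ} (x : Fin N → E3) (i : Fin N) : ℕ :=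
  Nat.card {j : Fin N // j ≠ i ∧ dist (x i) (x j) ≤ r}

/-- COORDINATION-FLOORED BUDGET(P₀) with dial `(k, r)`: at scale `(R, η)` only the `(R, η)`-bad sites
with at least `k` other particles within distance `r` are priced. -/
def Budget (k : ℕ) (r : ℝ) (P₀ : PeriodicConfiguration 3) : Prop :=
  ∀ R η : ℝ, 0 < R → 0 < η → ∃ c : ℝ, 0 < c ∧
    ∀ (N : ℕ) (x : Fin N → E3), IsGroundState lennardJones x →
      c * (Nat.card {i : Fin N // ¬ LayeredGood R η x i ∧ k ≤ nearCount r x i} : ℝ) ≤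
        interactionEnergy lennardJones x - (N : ℝ) * P₀.energyPerParticle lennardJones

/-- Periodic windows along `x` (verbatim the conclusion of `ChessboardParticlePlanes.PeriodicWindows`). -/
def HasPeriodicWindows (x : (N : ℕ) → (Fin N → E3)) : Prop :=
  ∃ P : PeriodicConfiguration 3, ∀ R ε : ℝ, 0 < ε → ∃ᶠ N in atTop, ∃ t : E3,
    (∀ s ∈ P.points, ‖s‖ ≤ R → ∃ i : Fin N, dist (x N i + t) s ≤ ε) ∧
    (∀ i : Fin N, ‖x N i + t‖ ≤ R → ∃ s ∈ P.points, dist (x N i + t) s ≤ ε)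

/-- The graded family: FLOOR + the `(k, r)`-floored budget force periodic windows along ground states. -/
def KRung (k : ℕ) (r : ℝ) : Prop :=
  ∀ P₀ : PeriodicConfiguration 3, Floor P₀ → Budget k r P₀ →
    ∀ x : (N : ℕ) → (Fin N → E3), (∀ N, IsGroundState lennardJones (x N)) → HasPeriodicWindows x

/-- **The banked candidate rung** (first member above the floor): a certificate that never prices an
`8/7`-isolated defect already forces periodic windows along the ground states. -/
def BondedRung : Prop := KRung 1 (8 / 7)

/-- **Banked structural lemma (category (ii); not proved here).** No particle of a Lennard-Jones ground
state with `N ≥ 2` particles is `r`-isolated.  True for `r ≥ (11/5)^{1/6}` by the superharmonic cut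
(§Flatness); with it `BondedRung` reduces to the floor. -/
def NoIsolatedSite (r : ℝ) : Prop :=
  ∀ (N : ℕ) (x : Fin N → E3), IsGroundState lennardJones x → 2 ≤ N → ∀ i : Fin N, 1 ≤ nearCount r x i

/-! ## Dial monotonicity -/

/-- A budget pricing the larger set prices the smaller one. -/
theorem budget_anti {k k' : ℕ} (h : k ≤ k') (r : ℝ) (P₀ : PeriodicConfiguration 3) :
    Budget k r P₀ → Budget k' r P₀ := by
  classical
  intro hB R η hR hη
  obtain ⟨c, hc, hcB⟩ := hB R η hR hη
  refine ⟨c, hc, fun N x hx => le_trans ?_ (hcB N x hx)⟩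
  have hle : Nat.card {i : Fin N // ¬ LayeredGood R η x i ∧ k' ≤ nearCount r x i} ≤
      Nat.card {i : Fin N // ¬ LayeredGood R η x i ∧ k ≤ nearCount r x i} := by
    rw [Nat.card_eq_fintype_card, Nat.card_eq_fintype_card]
    exact Fintype.card_subtype_mono _ _ fun i hi => ⟨hi.1, h.trans hi.2⟩
  exact mul_le_mul_of_nonneg_left (by exact_mod_cast hle) hc.le

/-- `KRung` is MONOTONE in the coordination floor: raising `k` un-prices more sites and strengthens the
rung. -/
theorem kRung_mono {k k' : ℕ} (h : k ≤ k') (r : ℝ) : KRung k' r → KRung k r :=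
  fun H P₀ hF hB x hx => H P₀ hF (budget_anti h r P₀ hB) x hx

/-! ## F3 — the family at `k = 0` is the proved floor -/

/-- **F3.** `KRung 0 r` — every bad site priced — is the seed `FloorGivesLayered_proof` followed by the
proved `PeriodicGivenLayered_holds`. [folklore] -/
theorem kRung_zero (r : ℝ) : KRung 0 r := by
  intro P₀ hF hB x hx
  refine Theses.FluxTubeKepler.PeriodicGivenLayered_holds x hx
    (Theorems.FluxTubeKeplerFloorGivesLayered.FloorGivesLayered_proof P₀ hF ?_ x hx)
  intro R η hR hη
  obtain ⟨c, hc, hcB⟩ := hB R η hR hη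
  refine ⟨c, hc, fun N y hy => ?_⟩
  show c * (Nat.card {i : Fin N // ¬ LayeredGood R η y i} : ℝ) ≤ _
  simpa only [zero_le, and_true] using hcB N y hy

example : KRung 0 (8 / 7) := kRung_zero _

/-- Every member of the family gives the floor value back. -/
theorem kRung_zero_of_kRung (k : ℕ) (r : ℝ) (h : KRung k r) : KRung 0 r :=
  kRung_mono (Nat.zero_le k) r h

theorem kRung_zero_of_bondedRung (h : BondedRung) : KRung 0 (8 / 7) :=
  kRung_zero_of_kRung 1 _ h

/-! ## F4 — on path: `Crystallization → KRung k r` -/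

/-- ON-PATH: the sub-problem implies every member of the family (landed hull-criterion converse). -/
theorem kRung_of_crystallization (k : ℕ) (r : ℝ) (h : _root_.Crystallization) : KRung k r :=
  fun _ _ _ x hx =>
    Theorems.ChessboardParticlePlanesPeriodicWindowsIffCrystallization.periodicWindows_of_crystallization
      h x hx

/-- **F4 — `Crystallization → BondedRung`.** -/
@[aesop safe apply]
theorem BondedRung_of_Crystallization (h : _root_.Crystallization) : BondedRung :=
  kRung_of_crystallization 1 _ h

end Summit.AtomisticToContinuum.Crystallization.Cruxes.FluxCellKepler.CoordLadder
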